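import Summits.AtomisticToContinuum.HydrodynamicLimit.Theses.JParityClosure

/-!
# `EvenStressEnskog` implies the Enskog collision-frequency law (split form)

Negative-side knowledge for the crux `JParityClosure.EvenStressEnskog` (stmt-AtomisticToContinuum-13079), from the
standing disprover's `Cruxes/EvenStressEnskog/Disproof.lean` §8. The trace of the momentum-transfer mark is the bare
collision-rate mark, `Σ_k Ξ_P^{kk}(n,v,w) = ((w−v)·n)₊‖n‖²`; the collision functional `K_N` is additive in the mark
along every good orbit (finitely many collision times in `[0,τ]`), and the bad set of the flow is null for the local
Gibbs law (`≪ liouville`). Hence the crux (its three diagonal components at tolerance `η/3`, confidence `δ/3`)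
implies, by a union bound, the **Enskog collision-frequency law**: with the same quantifier prefix and the same
`let`-bound objects as the crux, the RATE functional `K_N[χ g(σ³ρ_r) ((w−v)·n̂)₊]` of the true dynamics is within `η`
of `Σ_k σ³∫∫ χ g Y B(Ξ_P^{kk})` with probability `≥ 1 − δ` (the Enskog side is kept as the sum of the three diagonal
terms — equal to `σ³∫∫χ g Y B(rate mark)` whenever the Bochner integrals are honest — so that no integrability
enters). Read contrapositively this is the formal KILL TARGET recorded in the Disproof: any Euler-scale anomaly of
the collision frequency of deterministic hard spheres under local Gibbs data refutes the crux.
refuter-cdisprove-stmt-AtomisticToContinuum-13079-0.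
-/

noncomputable section

namespace Summit.AtomisticToContinuum.HydrodynamicLimit.Theorems

open scoped InnerProductSpace ENNReal
open MeasureTheory Filter Set
open Literature.MathematicalPhysics.KineticTheory Literature.Analysis.FluidPDE

namespace EvenStressEnskog

/-- Trace of the momentum-transfer mark = bare rate mark. [folklore] -/
theorem rateMark_eq_sum_diag (q : V3 × V3 × V3) :
    max ⟪q.2.2 - q.2.1, q.1⟫_ℝ 0 * ‖q.1‖ ^ 2 = ∑ k : Fin 3, max ⟪q.2.2 - q.2.1, q.1⟫_ℝ 0 * (q.1 k * q.1 k) := by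
  rw [← Finset.mul_sum, EuclideanSpace.real_norm_sq_eq]
  congr 1
  refine Finset.sum_congr rfl fun k _ => ?_
  rw [sq]

/-- The normalised collision functional is additive in the mark along a path with finitely many collision times
in the window. [folklore] -/
theorem collisionFunctional_sum {N : ℕ} (c₀ : ℝ) (S : Set ℝ) (hS : S.Finite)
    (P : ℝ → Fin (N + 1) → Fin (N + 1) → Prop) [∀ s i j, Decidable (P s i j)]
    (F : Fin 3 → ℝ → Fin (N + 1) → Fin (N + 1) → ℝ) :
    c₀ * ∑ᶠ (s : ℝ) (_ : s ∈ S), ∑ i : Fin (N + 1), ∑ j : Fin (N + 1),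
        (if P s i j then ∑ k, F k s i j else 0)
      = ∑ k, c₀ * ∑ᶠ (s : ℝ) (_ : s ∈ S), ∑ i : Fin (N + 1), ∑ j : Fin (N + 1),
        (if P s i j then F k s i j else 0) := by
  simp_rw [finsum_mem_eq_finite_toFinset_sum _ hS]
  rw [← Finset.mul_sum]
  congr 1
  set T := hS.toFinset with hT
  have hite : ∀ s (i j : Fin (N + 1)),
      (if P s i j then ∑ k, F k s i j else 0) = ∑ k, (if P s i j then F k s i j else 0) := by
    intro s i j; split_ifs <;> simp
  calc ∑ s ∈ T, ∑ i, ∑ j, (if P s i j then ∑ k, F k s i j else 0)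
      = ∑ s ∈ T, ∑ i, ∑ j, ∑ k, (if P s i j then F k s i j else 0) := by simp_rw [hite]
    _ = ∑ s ∈ T, ∑ i, ∑ k, ∑ j, (if P s i j then F k s i j else 0) :=
        Finset.sum_congr rfl fun s _ => Finset.sum_congr rfl fun i _ => Finset.sum_comm
    _ = ∑ s ∈ T, ∑ k, ∑ i, ∑ j, (if P s i j then F k s i j else 0) :=
        Finset.sum_congr rfl fun s _ => Finset.sum_comm
    _ = ∑ k, ∑ s ∈ T, ∑ i, ∑ j, (if P s i j then F k s i j else 0) := Finset.sum_comm

/-- Union bound over the three diagonal components, off a null set. [folklore] -/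
theorem measure_rate_le {Ω : Type*} [MeasurableSpace Ω] (P : Measure Ω) (good : Set Ω)
    (hgood : P goodᶜ = 0) (K I : Fin 3 → Ω → ℝ) (Krate : Ω → ℝ)
    (hlin : ∀ z ∈ good, Krate z = ∑ k, K k z) {η δ : ℝ}
    (hk : ∀ k, P {z | η / 3 < |K k z - I k z|} ≤ ENNReal.ofReal (δ / 3)) :
    P {z | η < |Krate z - ∑ k, I k z|} ≤ ENNReal.ofReal δ := by
  set A : Set Ω := {z | η < |Krate z - ∑ k, I k z|} with hA
  have hsub : A ∩ good ⊆ ⋃ k, {z | η / 3 < |K k z - I k z|} := by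
    rintro z ⟨hzA, hzg⟩
    rw [Set.mem_iUnion]
    by_contra hno
    push Not at hno
    have hle : ∀ k, |K k z - I k z| ≤ η / 3 := fun k => by
      have := hno k; simp only [Set.mem_setOf_eq, not_lt] at this; exact this
    have h1 : Krate z - ∑ k, I k z = ∑ k, (K k z - I k z) := by
      rw [hlin z hzg, Finset.sum_sub_distrib]
    have h2 : |Krate z - ∑ k, I k z| ≤ η := by
      rw [h1]
      calc |∑ k, (K k z - I k z)| ≤ ∑ k, |K k z - I k z| := Finset.abs_sum_le_sum_abs _ _
        _ ≤ ∑ _k : Fin 3, η / 3 := Finset.sum_le_sum fun k _ => hle k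
        _ = η := by simp [Finset.sum_const]; ring
    have : η < |Krate z - ∑ k, I k z| := hzA
    linarith
  calc P A ≤ P (A ∩ good ∪ goodᶜ) := by
        refine measure_mono fun z hz => ?_
        by_cases hzg : z ∈ good
        · exact Or.inl ⟨hz, hzg⟩
        · exact Or.inr hzg
    _ ≤ P (A ∩ good) + P goodᶜ := measure_union_le _ _
    _ = P (A ∩ good) := by rw [hgood, add_zero]
    _ ≤ P (⋃ k, {z | η / 3 < |K k z - I k z|}) := measure_mono hsub
    _ ≤ ∑ k, P {z | η / 3 < |K k z - I k z|} := measure_iUnion_fintype_le _ _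
    _ ≤ ∑ _k : Fin 3, ENNReal.ofReal (δ / 3) := Finset.sum_le_sum fun k _ => hk k
    _ = ENNReal.ofReal δ := by
        rw [Finset.sum_const, Finset.card_fin, nsmul_eq_mul, Nat.cast_ofNat,
          ← ENNReal.ofReal_ofNat 3, ← ENNReal.ofReal_mul (by norm_num)]
        congr 1; ring

/-- The bad set of a hard-sphere flow is null for the local Gibbs law. [folklore] -/
theorem localGibbsLaw_compl_good {σ : ℝ} {a₀ θ₀ : T3 → ℝ} {u₀ : T3 → V3} {N : ℕ}
    (Φ : HardSphereFlow (Torus.geometry (Fin 3)) (hsDiameter σ N) (N + 1)) :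
    localGibbsLaw σ a₀ u₀ θ₀ N Φ Φ.goodᶜ = 0 := by
  unfold localGibbsLaw particleLaw
  exact withDensity_absolutelyContinuous _ _ Φ.measure_compl_good

/-- **`EvenStressEnskog` ⇒ Enskog collision-frequency law (split form).** Same prefix and `let`-objects as the crux;
conclusion for the bare rate mark `Ξrate(n,v,w) = ((w−v)·n)₊‖n‖²` against the sum of the three diagonal Enskog terms.
[folklore] -/
theorem frequencyLawSplit_of_evenStressEnskog
    (h : Summit.AtomisticToContinuum.HydrodynamicLimit.Theses.JParityClosure.EvenStressEnskog) :
    ∃ η₀ : ℝ, 0 < η₀ ∧ ∀ (a₀ θ₀ : Literature.MathematicalPhysics.KineticTheory.T3 → ℝ) (u₀ : Literature.MathematicalPhysics.KineticTheory.T3 → Literature.MathematicalPhysics.KineticTheory.V3), Continuous a₀ → Continuous θ₀ → Continuous u₀ → (∀ x, 0 < a₀ x) → (∀ x, 0 < θ₀ x) → ∃ σ₀ : ℝ, 0 < σ₀ ∧ ∀ σ : ℝ, 0 < σ → σ < σ₀ → ∀ Φ : (N : ℕ) → Literature.Analysis.FluidPDE.HardSphereFlow (Literature.Analysis.FluidPDE.Torus.geometry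 (Fin 3)) (Literature.MathematicalPhysics.KineticTheory.hsDiameter σ N) (N + 1), ∀ τ : ℝ, 0 < τ → ∀ χ : ℝ × UnitAddTorus (Fin 3) → ℝ, Continuous χ → ∀ g : ℝ → ℝ, Continuous g → (∀ a, η₀ ≤ a → g a = 0) → ∀ η δ : ℝ, 0 < η → 0 < δ → ∃ r₀ : ℝ, 0 < r₀ ∧ ∀ r : ℝ, 0 < r → r < r₀ → ∃ N₀ : ℕ, ∀ N : ℕ, N₀ ≤ N → let ε := Literature.MathematicalPhysics.KineticTheory.hsDiameter σ N; let G := Literature.Analysis.FluidPDE.Torus.geometry (Fin 3); let γ := fun z (s : ℝ) => (Φ N).flow s z; let bx : UnitAddTorus (Fin 3) → UnitAddTorus (Fin 3) → ℝ := fun x y => 3 / (Real.pi * r ^ 3) * max (1 - Literature.Analysis.FluidPDE.Torus.euclidDist x y / r) 0; let ρm := fun z s (x₀ : UnitAddTorus (Fin 3)) => ∫ q, bx q.1 x₀ ∂(Literature.Analysis.FluidPDE.empiricalMeasure (γ z s)); let Θ := fun (Ξ : EuclideanSpace ℝ (Fin 3) × EuclideanSpace ℝ (Fin 3) × EuclideanSpace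 ℝ (Fin 3) → ℝ) (v w : EuclideanSpace ℝ (Fin 3)) => ∫ ω : Metric.sphere (0 : EuclideanSpace ℝ (Fin 3)) 1, Ξ ((ω : EuclideanSpace ℝ (Fin 3)), v, w) * Literature.MathematicalPhysics.KineticTheory.hardSphereKernel (w, v) ω ∂Literature.MathematicalPhysics.KineticTheory.sphereMeasure; let B := fun Ξ z s (x₀ : UnitAddTorus (Fin 3)) => ∫ p, bx p.1.1 x₀ * bx p.2.1 x₀ * Θ Ξ p.1.2 p.2.2 ∂((Literature.Analysis.FluidPDE.empiricalMeasure (γ z s)).prod (Literature.Analysis.FluidPDE.empiricalMeasure (γ z s))); let pv := fun z s (i j : Fin (N + 1)) => Literature.Analysis.FluidPDE.reflectVel (G.sepVec (γ z s i).1 (γ z s j).1) ((γ z s i).2, (γ z s j).2); let Kc := fun (Fn : Literature.Analysis.FluidPDE.Config (N + 1) (Fin 3) Literature.MathematicalPhysics.KineticTheory.T3 → ℝ → Fin (N + 1) → Fin (N + 1) → ℝ) z => ε / (N + 1 : ℝ) * ∑ᶠ (s : ℝ) (_ : s ∈ Literature.Analysis.FluidPDE.collisionTimes G ε (γ z) ∩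 Set.Icc 0 τ), ∑ i : Fin (N + 1), ∑ j : Fin (N + 1), (if i ≠ j ∧ ‖G.sepVec (γ z s i).1 (γ z s j).1‖ = ε then Fn z s i j else 0); let Y : ℝ → ℝ := fun a => 3 / (2 * Real.pi) * deriv Literature.MathematicalPhysics.KineticTheory.hsExcessFreeEnergy a; let ΞP := fun (k l : Fin 3) (q : EuclideanSpace ℝ (Fin 3) × EuclideanSpace ℝ (Fin 3) × EuclideanSpace ℝ (Fin 3)) => max ⟪q.2.2 - q.2.1, q.1⟫_ℝ 0 * (q.1 k * q.1 l); let Ξrate := fun (q : EuclideanSpace ℝ (Fin 3) × EuclideanSpace ℝ (Fin 3) × EuclideanSpace ℝ (Fin 3)) => max ⟪q.2.2 - q.2.1, q.1⟫_ℝ 0 * ‖q.1‖ ^ 2; Literature.MathematicalPhysics.KineticTheory.localGibbsLaw σ a₀ u₀ θ₀ N (Φ N) {z | η < |Kc (fun z s i j => χ (s, (γ z s i).1) * g (σ ^ 3 * ρm z s (γ z s i).1) * Ξrate (ε⁻¹ • G.sepVec (γ z s i).1 (γ z s j).1, (pv z s i j).1, (pv z s i j).2)) z - ∑ k : Fin 3,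 σ ^ 3 * ∫ s in Set.Icc (0 : ℝ) τ, ∫ x : UnitAddTorus (Fin 3), χ (s, x) * g (σ ^ 3 * ρm z s x) * Y (σ ^ 3 * ρm z s x) * B (ΞP k k) z s x|} ≤ ENNReal.ofReal δ := by
  obtain ⟨η₀, hη₀, h⟩ := h
  refine ⟨η₀, hη₀, fun a₀ θ₀ u₀ ha hθ hu ha0 hθ0 => ?_⟩
  obtain ⟨σ₀, hσ₀, h⟩ := h a₀ θ₀ u₀ ha hθ hu ha0 hθ0
  refine ⟨σ₀, hσ₀, fun σ hσ hσlt Φ τ hτ χ hχ g hg hg0 η δ hη hδ => ?_⟩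
  obtain ⟨r₀, hr₀, h⟩ :=
    h σ hσ hσlt Φ τ hτ χ hχ g hg hg0 (η / 3) (δ / 3) (by positivity) (by positivity)
  refine ⟨r₀, hr₀, fun r hr hrlt => ?_⟩
  obtain ⟨N₀, h⟩ := h r hr hrlt
  refine ⟨N₀, fun N hN => ?_⟩
  have hk := h N hN
  intro ε G γ bx ρm Θ B pv Kc Y ΞP Ξrate
  refine measure_rate_le _ (Φ N).good (localGibbsLaw_compl_good (Φ N))
    (fun k z => Kc (fun z s i j => χ (s, (γ z s i).1) * g (σ ^ 3 * ρm z s (γ z s i).1) *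
      ΞP k k (ε⁻¹ • G.sepVec (γ z s i).1 (γ z s j).1, (pv z s i j).1, (pv z s i j).2)) z)
    (fun k z => σ ^ 3 * ∫ s in Set.Icc (0 : ℝ) τ, ∫ x : UnitAddTorus (Fin 3),
      χ (s, x) * g (σ ^ 3 * ρm z s x) * Y (σ ^ 3 * ρm z s x) * B (ΞP k k) z s x)
    (fun z => Kc (fun z s i j => χ (s, (γ z s i).1) * g (σ ^ 3 * ρm z s (γ z s i).1) *
      Ξrate (ε⁻¹ • G.sepVec (γ z s i).1 (γ z s j).1, (pv z s i j).1, (pv z s i j).2)) z) ?_ ?_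
  · intro z hz
    have hfin : (collisionTimes G ε (γ z) ∩ Set.Icc 0 τ).Finite :=
      ((Φ N).isTrajectory z hz).locFinite 0 τ
    have hadd := collisionFunctional_sum (ε / (N + 1 : ℝ)) _ hfin
      (fun s i j => i ≠ j ∧ ‖G.sepVec (γ z s i).1 (γ z s j).1‖ = ε)
      (fun k s i j => χ (s, (γ z s i).1) * g (σ ^ 3 * ρm z s (γ z s i).1) *
        ΞP k k (ε⁻¹ • G.sepVec (γ z s i).1 (γ z s j).1, (pv z s i j).1, (pv z s i j).2))
    refine Eq.trans ?_ hadd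
    unfold Kc
    try dsimp only
    congr 1
    refine finsum_congr fun s => finsum_congr fun _ => ?_
    refine Finset.sum_congr rfl fun i _ => Finset.sum_congr rfl fun j _ => ?_
    split_ifs
    · rw [← Finset.mul_sum]
      congr 1
      exact rateMark_eq_sum_diag _
    · rfl
  · intro k
    exact hk k k

end EvenStressEnskog

end Summit.AtomisticToContinuum.HydrodynamicLimit.Theorems

end
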